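import Summits.CriticalPhenomena.PercolationContinuityZ3.Theorems.PercNearOneGluingNoHeavyPcintBFibRun
import Mathlib.Combinatorics.SimpleGraph.Finite
import HarnessLib

/-!
# PCINT lane, T-fibre route PHASE 3 (bond), step (1): the EDGE exploration of a bond cluster and its terminal states

Cell `prim-pcint`, seat `prim-pcint-1` (gen 13); memo `run/shared/lean/prim/pcint/T-FIBRE-ROUTE.md` (PHASE 3).

The bond analogue of `…PcintClusterExploration.lean`: the items examined by the adaptive domination theorem
`AdaptDom.expect_le_of_dominating` are now the EDGES of a finite graph (the pairs `e ∈ Λ.sym2` that are edges of an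
ambient graph `G`, `EdgeExpl.EΛ`), a state is a partial assignment `σ : EΛ → Option Bool`, and

* `reached σ` — the root `o` and the endpoints of the edges revealed OPEN;
* `linkable σ c` — the unrevealed edges from `c` to a site not yet reached; `cands`, `sel` — the `enc`-least reached
  site with a linkable edge; `rule σ` — its linkable edges (all examined at once), `∅` if none (terminal).

With the generic run lemmas of `…PcintBFibRun.lean`: `reached_mono`, `sel_unique` (a site is selected at most once), the tree invariant `treach_of_reached`
(every reached site is joined to the root by revealed-open edges), the closure of terminal states, and the payoff
`reachInd B` = `𝟙{some site of B is joined to o by open edges}` — monotone (`reachInd_mono`) and determined at terminal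
states (`reach_determined`).  Pure combinatorics; no probability here.
-/

namespace Summit.CriticalPhenomena.PercolationContinuityZ3.Theorems.Pcint

open Finset

/-! ### The edge exploration -/

namespace EdgeExpl

open AdaptDom

variable {W : Type*} [DecidableEq W] (G : SimpleGraph W) [DecidableRel G.Adj] (Λ : Finset W)

/-- The items: the pairs of sites of `Λ` that are edges of `G`. -/
def EΛ : Finset (Sym2 W) := (Λ.sym2).filter fun e => e ∈ G.edgeSet

variable {G Λ}

omit [DecidableEq W] in
/-- Members of `EΛ` are edges of `G` with both endpoints in `Λ`. -/
theorem mem_EΛ_iff {e : Sym2 W} : e ∈ EΛ G Λ ↔ (∀ a ∈ e, a ∈ Λ) ∧ e ∈ G.edgeSet := by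
  unfold EΛ; rw [mem_filter, Finset.mem_sym2_iff]

omit [DecidableEq W] in
/-- The pair of two adjacent sites of `Λ` is an item. -/
theorem mk_mem_EΛ {a b : ↥Λ} (h : G.Adj a.1 b.1) : s(a.1, b.1) ∈ EΛ G Λ := by
  rw [mem_EΛ_iff]
  refine ⟨fun x hx => ?_, (SimpleGraph.mem_edgeSet G).2 h⟩
  rcases Sym2.mem_iff.1 hx with rfl | rfl
  · exact a.2
  · exact b.2

omit [DecidableEq W] in
/-- An item written from one of its endpoints `c`: the other endpoint is a site of `Λ` adjacent to `c`. -/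
theorem exists_other {e : ↥(EΛ G Λ)} {c : ↥Λ} (hc : c.1 ∈ (e : Sym2 W)) :
    ∃ a : ↥Λ, (e : Sym2 W) = s(c.1, a.1) ∧ G.Adj c.1 a.1 := by
  obtain ⟨e, he⟩ := e
  induction e using Sym2.ind with
  | _ x y =>
    obtain ⟨hΛ, hE⟩ := mem_EΛ_iff.1 he
    have hxy : G.Adj x y := (SimpleGraph.mem_edgeSet G).1 hE
    rcases Sym2.mem_iff.1 hc with h | h
    · exact ⟨⟨y, hΛ y (Sym2.mem_iff.2 (Or.inr rfl))⟩, by simp [h], by rw [h]; exact hxy⟩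
    · exact ⟨⟨x, hΛ x (Sym2.mem_iff.2 (Or.inl rfl))⟩, by simp [h, Sym2.eq_swap], by rw [h]; exact hxy.symm⟩

omit [DecidableEq W] [DecidableRel G.Adj] in
/-- Two items from the same endpoint with the same pair have the same other endpoint. -/
theorem eq_of_mk_eq {c a a' : ↥Λ} (hca : G.Adj c.1 a.1) (h : s(c.1, a.1) = s(c.1, a'.1)) : a = a' := by
  have : a.1 = a'.1 := by
    rcases Sym2.eq_iff.1 h with ⟨-, h2⟩ | ⟨-, h2⟩
    · exact h2
    · exact absurd h2.symm hca.ne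
  exact Subtype.ext this

variable (o : ↥Λ) (enc : ↥Λ → ℕ)

/-- **Reached sites**: the root and the endpoints of the edges revealed open. -/
def reached (σ : ↥(EΛ G Λ) → Option Bool) : Finset ↥Λ :=
  univ.filter fun v => v = o ∨ ∃ e : ↥(EΛ G Λ), σ e = some true ∧ v.1 ∈ (e : Sym2 W)

/-- **Linkable edges of `c`**: unrevealed, leading to a site not yet reached. -/
def linkable (σ : ↥(EΛ G Λ) → Option Bool) (c : ↥Λ) : Finset ↥(EΛ G Λ) :=
  univ.filter fun e => σ e = none ∧ ∃ a : ↥Λ, a ∉ reached o σ ∧ (e : Sym2 W) = s(c.1, a.1)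

/-- The candidates for selection: reached sites with a linkable edge. -/
def cands (σ : ↥(EΛ G Λ) → Option Bool) : Finset ↥Λ := (reached o σ).filter fun c => (linkable o σ c).Nonempty

/-- The selected site: the `enc`-least candidate, if any. -/
noncomputable def sel (σ : ↥(EΛ G Λ) → Option Bool) : Option ↥Λ :=
  if h : (cands o σ).Nonempty then some (Classical.choose (exists_min_image (cands o σ) enc h)) else none

/-- **The edge exploration rule**: the linkable edges of the selected site; nothing if no site is selected. -/
noncomputable def rule (σ : ↥(EΛ G Λ) → Option Bool) : Finset ↥(EΛ G Λ) :=
  match sel o enc σ with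
  | none => ∅
  | some c => linkable o σ c

variable {o enc}

/-- Membership in `reached`. -/
theorem mem_reached_iff {σ : ↥(EΛ G Λ) → Option Bool} {v : ↥Λ} :
    v ∈ reached o σ ↔ v = o ∨ ∃ e : ↥(EΛ G Λ), σ e = some true ∧ v.1 ∈ (e : Sym2 W) := by
  unfold reached; rw [mem_filter]; simp only [mem_univ, true_and]

/-- The root is reached. -/
theorem root_mem_reached (σ : ↥(EΛ G Λ) → Option Bool) : o ∈ reached o σ := mem_reached_iff.2 (Or.inl rfl)

/-- Membership in `linkable`. -/
theorem mem_linkable_iff {σ : ↥(EΛ G Λ) → Option Bool} {c : ↥Λ} {e : ↥(EΛ G Λ)} :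
    e ∈ linkable o σ c ↔ σ e = none ∧ ∃ a : ↥Λ, a ∉ reached o σ ∧ (e : Sym2 W) = s(c.1, a.1) := by
  unfold linkable; rw [mem_filter]; simp only [mem_univ, true_and]

/-- The selected site is a candidate of least rank. -/
theorem sel_spec {σ : ↥(EΛ G Λ) → Option Bool} {c : ↥Λ} (hc : sel o enc σ = some c) :
    c ∈ cands o σ ∧ ∀ c' ∈ cands o σ, enc c ≤ enc c' := by
  unfold sel at hc
  split_ifs at hc with h
  · have := Classical.choose_spec (exists_min_image (cands o σ) enc h)
    rw [Option.some.injEq] at hc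
    rw [← hc]; exact this

/-- No site is selected iff there is no candidate. -/
theorem sel_eq_none_iff {σ : ↥(EΛ G Λ) → Option Bool} : sel o enc σ = none ↔ cands o σ = ∅ := by
  unfold sel
  split_ifs with h
  · simp only [false_iff]; exact h.ne_empty
  · simp only [true_iff]; exact not_nonempty_iff_eq_empty.1 h

/-- A selected site is reached and has a linkable edge. -/
theorem sel_reached {σ : ↥(EΛ G Λ) → Option Bool} {c : ↥Λ} (hc : sel o enc σ = some c) :
    c ∈ reached o σ ∧ (linkable o σ c).Nonempty := by
  have h := (sel_spec hc).1
  unfold cands at h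
  exact mem_filter.1 h

/-- With selected site `c`, the rule is the set of linkable edges of `c`. -/
theorem rule_of_sel {σ : ↥(EΛ G Λ) → Option Bool} {c : ↥Λ} (hc : sel o enc σ = some c) :
    rule o enc σ = linkable o σ c := by
  unfold rule; rw [hc]

/-- With no selected site, the rule is empty. -/
theorem rule_of_sel_none {σ : ↥(EΛ G Λ) → Option Bool} (h : sel o enc σ = none) : rule o enc σ = ∅ := by
  unfold rule; rw [h]

/-- **The rule examines only unrevealed items.** -/
theorem rule_unrevealed (σ : ↥(EΛ G Λ) → Option Bool) (e : ↥(EΛ G Λ)) (he : e ∈ rule o enc σ) : σ e = none := by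
  cases hsel : sel o enc σ with
  | none => rw [rule_of_sel_none hsel] at he; simp at he
  | some c => rw [rule_of_sel hsel, mem_linkable_iff] at he; exact he.1

/-- An examined item is a linkable edge of the selected site: unrevealed, from the selected site to an unreached site. -/
theorem exists_of_mem_rule {σ : ↥(EΛ G Λ) → Option Bool} {e : ↥(EΛ G Λ)} (he : e ∈ rule o enc σ) :
    ∃ c, sel o enc σ = some c ∧ σ e = none ∧ ∃ a : ↥Λ, a ∉ reached o σ ∧ (e : Sym2 W) = s(c.1, a.1) := by
  cases hsel : sel o enc σ with
  | none => rw [rule_of_sel_none hsel] at he; simp at he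
  | some c => rw [rule_of_sel hsel, mem_linkable_iff] at he; exact ⟨c, rfl, he⟩

/-- If the rule is empty then no site is selected. -/
theorem sel_eq_none_of_rule_eq_empty {σ : ↥(EΛ G Λ) → Option Bool} (h : rule o enc σ = ∅) : sel o enc σ = none := by
  cases hsel : sel o enc σ with
  | none => rfl
  | some c =>
    exfalso
    have hne := (sel_reached hsel).2
    rw [rule_of_sel hsel] at h
    exact hne.ne_empty h

/-- **Terminal states are closed**: if the rule is empty, every edge from a reached site to an unreached site is
revealed. -/
theorem ne_none_of_rule_eq_empty {σ : ↥(EΛ G Λ) → Option Bool} (h : rule o enc σ = ∅) {c a : ↥Λ}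
    (hc : c ∈ reached o σ) (ha : a ∉ reached o σ) {e : ↥(EΛ G Λ)} (he : (e : Sym2 W) = s(c.1, a.1)) : σ e ≠ none := by
  intro hσ
  have hsel := sel_eq_none_of_rule_eq_empty h
  rw [sel_eq_none_iff] at hsel
  have : c ∈ cands o σ := by
    unfold cands
    exact mem_filter.2 ⟨hc, e, mem_linkable_iff.2 ⟨hσ, a, ha, he⟩⟩
  rw [hsel] at this; simp at this

/-! ### Along a run -/

section Run

variable (x : (↥(EΛ G Λ) → Option Bool) → ↥(EΛ G Λ) → Bool)

/-- Reached sets grow along a run. -/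
theorem reached_mono {k n : ℕ} (hkn : k ≤ n) :
    reached o (run (rule o enc) x k) ⊆ reached o (run (rule o enc) x n) := by
  intro v hv
  rcases mem_reached_iff.1 hv with h | ⟨e, he, hv⟩
  · exact mem_reached_iff.2 (Or.inl h)
  · refine mem_reached_iff.2 (Or.inr ⟨e, ?_, hv⟩)
    rw [run_apply_of_ne_none (rule_unrevealed (o := o) (enc := enc)) x (by rw [he]; simp) n hkn, he]

/-- **A site is selected at most once**: the site selected at step `k` is not selected at any later step. -/
theorem sel_unique {k n : ℕ} (hkn : k < n) {c : ↥Λ} (hk : sel o enc (run (rule o enc) x k) = some c) :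
    sel o enc (run (rule o enc) x n) ≠ some c := by
  intro hn
  obtain ⟨-, e, he⟩ := sel_reached hn
  rw [mem_linkable_iff] at he
  obtain ⟨hσ, a, ha, hea⟩ := he
  -- `e` was already linkable at step `k`, hence examined then and revealed at step `n`
  have hek : e ∈ rule o enc (run (rule o enc) x k) := by
    rw [rule_of_sel hk, mem_linkable_iff]
    exact ⟨run_apply_eq_none_of_le' (rule_unrevealed (o := o) (enc := enc)) x hkn.le hσ, a,
      fun h => ha (reached_mono x hkn.le h), hea⟩
  exact not_mem_of_run_apply_eq_none (rule_unrevealed (o := o) (enc := enc)) x hkn hσ hek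

variable (o) in
/-- Joined to the root by revealed-open edges (a predicate of this file, not a cited fact). -/
def TReach (σ : ↥(EΛ G Λ) → Option Bool) (v : ↥Λ) : Prop :=
  Relation.ReflTransGen (fun a b : ↥Λ => ∃ e : ↥(EΛ G Λ), σ e = some true ∧ (e : Sym2 W) = s(a.1, b.1)) o v

/-- `TReach` persists along a run. -/
theorem treach_mono {k n : ℕ} (hkn : k ≤ n) {v : ↥Λ} (h : TReach o (run (rule o enc) x k) v) :
    TReach o (run (rule o enc) x n) v := by
  unfold TReach at h ⊢
  induction h with
  | refl => exact Relation.ReflTransGen.refl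
  | @tail a b _ hab ih =>
    obtain ⟨e, he, hab⟩ := hab
    refine ih.tail ⟨e, ?_, hab⟩
    rw [run_apply_of_ne_none (rule_unrevealed (o := o) (enc := enc)) x (by rw [he]; simp) n hkn, he]

/-- **The tree invariant**: every reached site is joined to the root by revealed-open edges. -/
theorem treach_of_reached : ∀ (n : ℕ) (v : ↥Λ), v ∈ reached o (run (rule o enc) x n) → TReach o (run (rule o enc) x n) v
  | 0, v, hv => by
    rcases mem_reached_iff.1 hv with rfl | ⟨e, he, -⟩
    · exact Relation.ReflTransGen.refl
    · exact absurd he (by simp [run])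
  | n + 1, v, hv => by
    rcases mem_reached_iff.1 hv with rfl | ⟨e, he, hve⟩
    · exact Relation.ReflTransGen.refl
    · set τ := run (rule o enc) x n with hτ
      by_cases hold : τ e = some true
      · exact treach_mono x (Nat.le_succ n) (treach_of_reached n v (mem_reached_iff.2 (Or.inr ⟨e, hold, hve⟩)))
      · -- `e` was revealed open at this very step: it is a linkable edge of the selected site
        have heR : e ∈ rule o enc τ := by
          by_contra heR
          have : run (rule o enc) x (n + 1) e = τ e := by
            change stepPA (rule o enc τ) τ (x τ) e = τ e; simp [stepPA, heR]
          rw [this] at he; exact hold he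
        obtain ⟨c, hsel, -, a, -, hea⟩ := exists_of_mem_rule heR
        have hc : TReach o (run (rule o enc) x (n + 1)) c :=
          treach_mono x (Nat.le_succ n) (treach_of_reached n c (sel_reached hsel).1)
        have hstep : ∀ b : ↥Λ, (e : Sym2 W) = s(c.1, b.1) → TReach o (run (rule o enc) x (n + 1)) b :=
          fun b hb => hc.tail ⟨e, he, hb⟩
        rw [hea] at hve
        rcases Sym2.mem_iff.1 hve with h | h
        · have : v = c := Subtype.ext h
          rw [this]; exact hc
        · have : v = a := Subtype.ext h
          rw [this]; exact hstep a hea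

end Run

/-! ### Open paths and the payoff -/

variable (o) in
/-- An open path from the root to `v` in the edge configuration `ω` (a predicate of this file, not a cited fact). -/
def ReachE (ω : ↥(EΛ G Λ) → Bool) (v : ↥Λ) : Prop :=
  Relation.ReflTransGen (fun a b : ↥Λ => ∃ e : ↥(EΛ G Λ), ω e = true ∧ (e : Sym2 W) = s(a.1, b.1)) o v

omit [DecidableEq W] in
/-- Open paths are monotone in the configuration. -/
theorem reachE_mono {ω ω' : ↥(EΛ G Λ) → Bool} (h : ∀ e, ω e ≤ ω' e) {v : ↥Λ} (hp : ReachE o ω v) : ReachE o ω' v := by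
  unfold ReachE at hp ⊢
  induction hp with
  | refl => exact Relation.ReflTransGen.refl
  | @tail a b _ hab ih =>
    obtain ⟨e, he, hab⟩ := hab
    refine ih.tail ⟨e, ?_, hab⟩
    have := h e; rw [he] at this; exact Bool.eq_true_of_true_le this

section Payoff

open Classical

variable (G o) in
/-- **The payoff**: `𝟙{some site of the target set B is joined to the root by open edges}`. -/
noncomputable def reachInd (B : Finset ↥Λ) (ω : ↥(EΛ G Λ) → Bool) : ℝ := if ∃ v ∈ B, ReachE (G := G) o ω v then 1 else 0

end Payoff

omit [DecidableEq W] in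
/-- The payoff is monotone in the configuration. -/
theorem reachInd_mono (B : Finset ↥Λ) : Monotone (reachInd G o B) := by
  intro ω ω' h
  unfold reachInd
  by_cases h1 : ∃ v ∈ B, ReachE o ω v
  · obtain ⟨v, hv, hp⟩ := h1
    rw [if_pos ⟨v, hv, hp⟩, if_pos ⟨v, hv, reachE_mono (fun e => h e) hp⟩]
  · rw [if_neg h1]; split_ifs <;> norm_num

omit [DecidableEq W] in
/-- A site joined to the root by revealed-open edges of `σ` is reached by an open path in every completion of `σ`. -/
theorem reachE_merge_of_treach {σ : ↥(EΛ G Λ) → Option Bool} {v : ↥Λ} (h : TReach o σ v) (ω : ↥(EΛ G Λ) → Bool) :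
    ReachE o (merge σ ω) v := by
  unfold TReach at h; unfold ReachE
  induction h with
  | refl => exact Relation.ReflTransGen.refl
  | @tail a b _ hab ih =>
    obtain ⟨e, he, hab⟩ := hab
    exact ih.tail ⟨e, by simp [merge, he], hab⟩

/-- **At a terminal state, open paths from the root in any completion stay inside the reached sites.** -/
theorem mem_reached_of_reachE {σ : ↥(EΛ G Λ) → Option Bool} (h : rule o enc σ = ∅) {ω : ↥(EΛ G Λ) → Bool} {v : ↥Λ}
    (hp : ReachE o (merge σ ω) v) : v ∈ reached o σ := by
  unfold ReachE at hp
  induction hp with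
  | refl => exact root_mem_reached σ
  | @tail a b _ hab ih =>
    obtain ⟨e, he, heab⟩ := hab
    by_contra hb
    cases hσ : σ e with
    | none => exact ne_none_of_rule_eq_empty h ih hb heab hσ
    | some t =>
      cases t with
      | false => simp [merge, hσ] at he
      | true => exact hb (mem_reached_iff.2 (Or.inr ⟨e, hσ, by rw [heab]; exact Sym2.mem_iff.2 (Or.inr rfl)⟩))

/-- **The payoff is determined at terminal states** (hypothesis `hdet` of `AdaptDom.expect_le_of_dominating`): after
`|EΛ| + 1` steps the value of `reachInd` no longer depends on the completion, for every oracle. -/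
theorem reach_determined (B : Finset ↥Λ) (x : (↥(EΛ G Λ) → Option Bool) → ↥(EΛ G Λ) → Bool) (ω ω₀ : ↥(EΛ G Λ) → Bool) :
    reachInd G o B (merge (run (rule o enc) x (Fintype.card ↥(EΛ G Λ) + 1)) ω) =
      reachInd G o B (merge (run (rule o enc) x (Fintype.card ↥(EΛ G Λ) + 1)) ω₀) := by
  set σ := run (rule o enc) x (Fintype.card ↥(EΛ G Λ) + 1) with hσ
  have hterm : rule o enc σ = ∅ := run_terminal (rule_unrevealed (o := o) (enc := enc)) x
  have key : ∀ ω' : ↥(EΛ G Λ) → Bool, (∃ v ∈ B, ReachE o (merge σ ω') v) ↔ ∃ v ∈ B, v ∈ reached o σ := by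
    intro ω'
    refine exists_congr fun v => and_congr_right fun _ => ⟨fun hp => mem_reached_of_reachE hterm hp, fun hv => ?_⟩
    exact reachE_merge_of_treach (treach_of_reached x _ v hv) ω'
  unfold reachInd
  by_cases h1 : ∃ v ∈ B, v ∈ reached o σ
  · rw [if_pos ((key ω).2 h1), if_pos ((key ω₀).2 h1)]
  · rw [if_neg (fun h => h1 ((key ω).1 h)), if_neg (fun h => h1 ((key ω₀).1 h))]

/-- If the payoff of the final state is `1`, some target site is reached. -/
theorem exists_reached_of_reachInd (B : Finset ↥Λ) (x : (↥(EΛ G Λ) → Option Bool) → ↥(EΛ G Λ) → Bool)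
    (ω₀ : ↥(EΛ G Λ) → Bool)
    (h : reachInd G o B (merge (run (rule o enc) x (Fintype.card ↥(EΛ G Λ) + 1)) ω₀) = 1) :
    ∃ v ∈ B, v ∈ reached o (run (rule o enc) x (Fintype.card ↥(EΛ G Λ) + 1)) := by
  have hterm := run_terminal (rule_unrevealed (o := o) (enc := enc)) x
  by_contra hne
  unfold reachInd at h
  rw [if_neg] at h
  · exact zero_ne_one h
  · rintro ⟨v, hv, hp⟩
    exact hne ⟨v, hv, mem_reached_of_reachE hterm hp⟩

end EdgeExpl

end Summit.CriticalPhenomena.PercolationContinuityZ3.Theorems.Pcint
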